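import Summits.CriticalPhenomena.PercolationContinuityZ3.Theorems.PercAnnulusCrossingNoiseFourier
import Literature.Probability.ODonnellSaksSchrammServedio2005.DecisionTreeCovarianceBiased
import HarnessLib

/-!
# RSW3 lane (lead, gen 20): NOISE SENSITIVITY OF CROSSINGS, II — Bessel's inequality, and SPLICING two inputs along a decision tree
# ("when the algorithm terminates, the unexamined bits are unbiased")

builds on p205010 (kernel theorem, internal audit signed; external expert review pending) — NOT used in this file (abstract).

Cell `prim-rsw3` (LANE 3), lead seat, gen 20.  Support file (`--supports stmt-CriticalPhenomena-4575`); no definitions, no named facts,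
no sorries.  Setting of part I (`…NoiseFourier`): finite product cube `ι → Bool`, biases `p ∈ [0,1]^ι`, product weight `wt p`, a character
system `r` ((H1) mean zero, (H2) reproducing kernel), Walsh characters `χ_S = Π_{i∈S} r_i` written out.  Decision trees are the reduced
deterministic `DecTree`s of the Literature OSSS library (`eval`, `vars`, `queried`, `Reduced`).  The SPLICE of `x` and `y` along `T` is the input
equal to `x` on `J(x) = T.queried x` and to `y` elsewhere, written as the lambda `fun j => if j ∈ T.queried x then x j else y j` (no definition).

* §0 `sum_sq_inner_le_of_orthogonal` — BESSEL: for a weight `w ≥ 0`, a finite pairwise-orthogonal family `v_a` with `Σ w v_a² ≤ 1` and any `h`,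
  `Σ_a (Σ_ω w·h·v_a)² ≤ Σ_ω w·h²`.
* §1 `queried_update_of_not_mem_vars`, `splice_node`, `splice_update_right`, `splice_update_left`, **`eval_splice`** (the output only reads the
  queried bits: `T.eval(splice_T(x,y)) = T.eval x`), **`sum_sum_wt_splice`** (RE-RANDOMISING THE UNQUERIED BITS PRESERVES THE LAW:
  `E_{x,y}[Φ(splice_T(x,y))] = E_x[Φ(x)]` for a reduced tree and independent `x, y ~ wt p` — by induction on the tree through the one-coordinate
  integration `sum_wt_ite`).
* §2 `sum_wt_char_splice_mul_char` — for `|U| = |S|` and `S ∩ J = ∅`: `E_y[χ_U(splice_J(x,y))·χ_S(y)] = 𝟙[U = S]·E[χ_S²]` (substituting the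
  queried values into a level-`k` character leaves the coefficient of a level-`k` character `χ_S` untouched iff `S` avoids `J`).

References: O. Schramm, J. Steif, *Quantitative noise sensitivity and exceptional times for percolation*, Ann. of Math. 171 (2010) 619–672,
§4 proof of Thm 1.8; C. Garban, J. Steif, *Noise sensitivity of Boolean functions and percolation*, CUP 2014, Ch. VIII §2 (proof of Thm VIII.1:
"when the algorithm terminates, the unexamined bits are unbiased"; `ĝ_J(S) = ĝ(S)` iff `S ∩ J = ∅`); R. O'Donnell, *Analysis of Boolean
Functions*, CUP 2014, §1.4 (Parseval/Bessel), §8.4.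
-/

noncomputable section

namespace Summit.CriticalPhenomena.PercolationContinuityZ3.Theorems.Crossing.Spectral

open Finset Function
open Literature.Probability.ODonnellSaksSchrammServedio2005

/-! ## §0 Bessel's inequality for a finite orthogonal family under a nonnegative weight -/

/-- **BESSEL'S INEQUALITY** (finite-dimensional, weighted): for a weight `w ≥ 0` on a finite type, a finite family `v_a` (`a ∈ A`) which
is pairwise orthogonal (`Σ_ω w·v_a·v_b = 0`, `a ≠ b`) with `Σ_ω w·v_a² ≤ 1`, and any `h`: `Σ_{a∈A} (Σ_ω w·h·v_a)² ≤ Σ_ω w·h²`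
(expand `0 ≤ Σ_ω w (h − Σ_a c_a v_a)²` with `c_a = ⟨h, v_a⟩`). [cite: ODonnell2014, §1.4 (Parseval/Bessel for orthonormal systems)] -/
theorem sum_sq_inner_le_of_orthogonal {Ω α : Type*} [Fintype Ω] [DecidableEq α] (w : Ω → ℝ) (hw : ∀ ω, 0 ≤ w ω)
    (A : Finset α) (v : α → Ω → ℝ) (horth : ∀ a ∈ A, ∀ b ∈ A, a ≠ b → ∑ ω, w ω * (v a ω * v b ω) = 0)
    (hnorm : ∀ a ∈ A, ∑ ω, w ω * (v a ω * v a ω) ≤ 1) (h : Ω → ℝ) :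
    ∑ a ∈ A, (∑ ω, w ω * (h ω * v a ω)) ^ 2 ≤ ∑ ω, w ω * (h ω * h ω) := by
  -- the coefficients and the projection `P = Σ_a c_a v_a`
  obtain ⟨c, hc⟩ : ∃ c : α → ℝ, c = fun a => ∑ ω, w ω * (h ω * v a ω) := ⟨_, rfl⟩
  obtain ⟨P, hP⟩ : ∃ P : Ω → ℝ, P = fun ω => ∑ a ∈ A, c a * v a ω := ⟨_, rfl⟩
  -- (i) `⟨h, P⟩ = Σ_a c_a²`
  have hhP : ∑ ω, w ω * (h ω * P ω) = ∑ a ∈ A, c a * c a := by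
    calc ∑ ω, w ω * (h ω * P ω) = ∑ ω, ∑ a ∈ A, c a * (w ω * (h ω * v a ω)) := by
          refine Finset.sum_congr rfl fun ω _ => ?_
          simp only [hP]
          rw [Finset.mul_sum, Finset.mul_sum]
          exact Finset.sum_congr rfl fun a _ => by ring
      _ = ∑ a ∈ A, c a * c a := by
          rw [Finset.sum_comm]
          refine Finset.sum_congr rfl fun a _ => ?_
          rw [hc, Finset.mul_sum]
  -- (ii) `⟨P, P⟩ = Σ_a c_a² ‖v_a‖² ≤ Σ_a c_a²`
  have hPP : ∑ ω, w ω * (P ω * P ω) = ∑ a ∈ A, c a * c a * ∑ ω, w ω * (v a ω * v a ω) := by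
    calc ∑ ω, w ω * (P ω * P ω) = ∑ ω, ∑ a ∈ A, ∑ b ∈ A, c a * c b * (w ω * (v a ω * v b ω)) := by
          refine Finset.sum_congr rfl fun ω _ => ?_
          simp only [hP]
          rw [Finset.sum_mul_sum, Finset.mul_sum]
          refine Finset.sum_congr rfl fun a _ => ?_
          rw [Finset.mul_sum]
          exact Finset.sum_congr rfl fun b _ => by ring
      _ = ∑ a ∈ A, ∑ b ∈ A, c a * c b * ∑ ω, w ω * (v a ω * v b ω) := by
          rw [Finset.sum_comm]
          refine Finset.sum_congr rfl fun a _ => ?_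
          rw [Finset.sum_comm]
          refine Finset.sum_congr rfl fun b _ => ?_
          rw [Finset.mul_sum]
      _ = ∑ a ∈ A, c a * c a * ∑ ω, w ω * (v a ω * v a ω) := by
          refine Finset.sum_congr rfl fun a ha => ?_
          rw [Finset.sum_eq_single_of_mem a ha]
          intro b hb hba
          rw [horth a ha b hb (Ne.symm hba), mul_zero]
  have hPP' : ∑ ω, w ω * (P ω * P ω) ≤ ∑ a ∈ A, c a * c a := by
    rw [hPP]
    refine Finset.sum_le_sum fun a ha => ?_
    have h1 := hnorm a ha
    have h2 : 0 ≤ c a * c a := mul_self_nonneg _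
    nlinarith
  -- (iii) `0 ≤ ‖h − P‖² = ‖h‖² − 2⟨h,P⟩ + ‖P‖²`
  have hpos : 0 ≤ ∑ ω, w ω * ((h ω - P ω) * (h ω - P ω)) :=
    Finset.sum_nonneg fun ω _ => mul_nonneg (hw ω) (mul_self_nonneg _)
  have hexp : ∑ ω, w ω * ((h ω - P ω) * (h ω - P ω))
      = (∑ ω, w ω * (h ω * h ω)) - 2 * (∑ ω, w ω * (h ω * P ω)) + ∑ ω, w ω * (P ω * P ω) := by
    have hpt : ∀ ω, w ω * ((h ω - P ω) * (h ω - P ω))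
        = w ω * (h ω * h ω) - 2 * (w ω * (h ω * P ω)) + w ω * (P ω * P ω) := fun ω => by ring
    simp_rw [hpt]
    rw [Finset.sum_add_distrib, Finset.sum_sub_distrib, Finset.mul_sum]
  rw [hexp, hhP] at hpos
  have hsq : ∑ a ∈ A, (∑ ω, w ω * (h ω * v a ω)) ^ 2 = ∑ a ∈ A, c a * c a :=
    Finset.sum_congr rfl fun a _ => by rw [hc]; ring
  rw [hsq]
  linarith

/-! ## §1 Splicing two inputs along a decision tree -/

section Splice

variable {ι : Type*} [DecidableEq ι]

/-- A subtree not containing `i` queries the same coordinates after coordinate `i` of the input is overwritten.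
[cite: OdonnellEtAl2005, §3.2 proof of Thm 3.1 (no variable queried twice)] -/
theorem queried_update_of_not_mem_vars {T : DecTree ι} {i : ι} (h : i ∉ T.vars) (x : ι → Bool) (c : Bool) :
    T.queried (update x i c) = T.queried x := by
  induction T with
  | leaf v => simp [DecTree.queried]
  | node j t₀ t₁ ih₀ ih₁ =>
    simp only [DecTree.vars, Finset.mem_insert, Finset.mem_union, not_or] at h
    obtain ⟨hij, h₀, h₁⟩ := h
    have hj : update x i c j = x j := update_of_ne (fun e => hij e.symm) _ _
    simp only [DecTree.queried, hj, ih₀ h₀, ih₁ h₁]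

/-- The splice along a node: query `i`, then splice along the chosen subtree with `y_i` overwritten by `x_i`.
[cite: SchrammSteif2010, §4 proof of Thm 1.8 (the configuration ω'' equal to ω on J and ω' off J)] -/
theorem splice_node (i : ι) (t₀ t₁ : DecTree ι) (x y : ι → Bool) :
    (fun j => if j ∈ (DecTree.node i t₀ t₁).queried x then x j else y j)
      = fun j => if j ∈ (if x i = true then t₁ else t₀).queried x then x j else update y i (x i) j := by
  funext j
  by_cases hji : j = i
  · subst hji
    simp only [DecTree.queried, Finset.mem_insert, true_or, if_true, update_self]
    split_ifs <;> rfl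
  · simp only [DecTree.queried, Finset.mem_insert, hji, false_or, update_of_ne hji]
    rcases Bool.eq_false_or_eq_true (x i) with hx | hx <;> simp [hx]

/-- Overwriting an unqueried coordinate of the second input commutes with splicing (for a subtree not containing it).
[cite: SchrammSteif2010, §4 proof of Thm 1.8 (the configuration ω'')] -/
theorem splice_update_right {T : DecTree ι} {i : ι} (h : i ∉ T.vars) (x y : ι → Bool) (c : Bool) :
    (fun j => if j ∈ T.queried x then x j else update y i c j) = update (fun j => if j ∈ T.queried x then x j else y j) i c := by
  funext j
  by_cases hji : j = i
  · subst hji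
    have : j ∉ T.queried x := fun hq => h (DecTree.queried_subset_vars T x hq)
    simp [this]
  · simp [update_of_ne hji]

/-- Overwriting an unqueried coordinate of the FIRST input does not change the splice (for a subtree not containing it).
[cite: SchrammSteif2010, §4 proof of Thm 1.8 (the configuration ω'')] -/
theorem splice_update_left {T : DecTree ι} {i : ι} (h : i ∉ T.vars) (x y : ι → Bool) (c : Bool) :
    (fun j => if j ∈ T.queried (update x i c) then update x i c j else y j) = fun j => if j ∈ T.queried x then x j else y j := by
  funext j
  rw [queried_update_of_not_mem_vars h]
  by_cases hj : j ∈ T.queried x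
  · have hji : j ≠ i := fun e => h (e ▸ DecTree.queried_subset_vars T x hj)
    simp [hj, update_of_ne hji]
  · simp [hj]

/-- **THE OUTPUT ONLY READS THE QUERIED BITS**: `T.eval (splice_T(x, y)) = T.eval x`.
[cite: SchrammSteif2010, §4 proof of Thm 1.8 (f is determined by the bits in J)] -/
theorem eval_splice (T : DecTree ι) (x y : ι → Bool) :
    T.eval (fun j => if j ∈ T.queried x then x j else y j) = T.eval x := by
  induction T generalizing y with
  | leaf v => simp [DecTree.eval]
  | node i t₀ t₁ ih₀ ih₁ =>
    rw [splice_node]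
    have hxi : (fun j => if j ∈ (if x i = true then t₁ else t₀).queried x then x j else update y i (x i) j) i = x i := by
      simp only [update_self]; split_ifs <;> rfl
    simp only [DecTree.eval, hxi]
    rcases Bool.eq_false_or_eq_true (x i) with hx | hx
    · simp only [hx, if_true]
      exact ih₁ _
    · simp only [hx, Bool.false_eq_true, if_false]
      exact ih₀ _

variable [Fintype ι]

/-- **RE-RANDOMISING THE UNQUERIED BITS PRESERVES THE LAW** (reduced tree): `E_{x,y}[Φ(splice_T(x,y))] = E_x[Φ(x)]` for independent `x, y`
of law `wt p` — conditionally on the transcript the unexamined bits are fresh with their biases.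
[cite: SchrammSteif2010, §4 proof of Thm 1.8 ("when the algorithm terminates, the unexamined bits are unbiased")] -/
theorem sum_sum_wt_splice (p : ι → ℝ) (T : DecTree ι) (hT : T.Reduced) (Φ : (ι → Bool) → ℝ) :
    ∑ x : ι → Bool, ∑ y : ι → Bool, wt p x * wt p y * Φ (fun j => if j ∈ T.queried x then x j else y j)
      = ∑ x : ι → Bool, wt p x * Φ x := by
  induction T generalizing Φ with
  | leaf v =>
    simp only [DecTree.queried, Finset.notMem_empty, if_false]
    rw [Finset.sum_comm]
    calc ∑ y : ι → Bool, ∑ x : ι → Bool, wt p x * wt p y * Φ (fun j => y j)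
        = ∑ y : ι → Bool, ∑ x : ι → Bool, wt p y * wt p x * Φ y :=
          Finset.sum_congr rfl fun y _ => Finset.sum_congr rfl fun x _ => by ring
      _ = ∑ x : ι → Bool, wt p x * Φ x := sum_sum_wt_mul_left p Φ
  | node i t₀ t₁ ih₀ ih₁ =>
    simp only [DecTree.Reduced] at hT
    obtain ⟨hi₀, hi₁, hr₀, hr₁⟩ := hT
    -- branch on `x_i`
    have hbranch : ∀ x y : ι → Bool, Φ (fun j => if j ∈ (DecTree.node i t₀ t₁).queried x then x j else y j)
        = if x i = true then Φ (update (fun j => if j ∈ t₁.queried x then x j else y j) i true)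
          else Φ (update (fun j => if j ∈ t₀.queried x then x j else y j) i false) := by
      intro x y
      rw [splice_node]
      rcases Bool.eq_false_or_eq_true (x i) with hx | hx
      · rw [if_pos hx, hx, if_pos rfl, splice_update_right hi₁]
      · rw [if_neg (by simp [hx]), hx, if_neg (by simp), splice_update_right hi₀]
    simp_rw [hbranch]
    have hsplit : ∀ x : ι → Bool, ∑ y : ι → Bool, wt p x * wt p y *
        (if x i = true then Φ (update (fun j => if j ∈ t₁.queried x then x j else y j) i true)
          else Φ (update (fun j => if j ∈ t₀.queried x then x j else y j) i false))
        = wt p x * (if x i = true then ∑ y : ι → Bool, wt p y * Φ (update (fun j => if j ∈ t₁.queried x then x j else y j) i true)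
          else ∑ y : ι → Bool, wt p y * Φ (update (fun j => if j ∈ t₀.queried x then x j else y j) i false)) := by
      intro x
      split_ifs <;> rw [Finset.mul_sum] <;> exact Finset.sum_congr rfl fun y _ => by ring
    simp_rw [hsplit]
    rw [sum_wt_ite p i _ _ (fun x c => by simp_rw [splice_update_left hi₁ x _ c])
      (fun x c => by simp_rw [splice_update_left hi₀ x _ c])]
    -- the inductive hypotheses for `Φ ∘ update(·, i, b)`
    have h₁ := ih₁ hr₁ (fun z => Φ (update z i true))
    have h₀ := ih₀ hr₀ (fun z => Φ (update z i false))
    have e₁ : ∑ x : ι → Bool, wt p x * ∑ y : ι → Bool, wt p y * Φ (update (fun j => if j ∈ t₁.queried x then x j else y j) i true)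
        = ∑ x : ι → Bool, wt p x * Φ (update x i true) := by
      rw [← h₁]
      refine Finset.sum_congr rfl fun x _ => ?_
      rw [Finset.mul_sum]
      exact Finset.sum_congr rfl fun y _ => by ring
    have e₀ : ∑ x : ι → Bool, wt p x * ∑ y : ι → Bool, wt p y * Φ (update (fun j => if j ∈ t₀.queried x then x j else y j) i false)
        = ∑ x : ι → Bool, wt p x * Φ (update x i false) := by
      rw [← h₀]
      refine Finset.sum_congr rfl fun x _ => ?_
      rw [Finset.mul_sum]
      exact Finset.sum_congr rfl fun y _ => by ring
    rw [e₁, e₀, ← sum_wt_ite p i (fun x => Φ (update x i true)) (fun x => Φ (update x i false))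
      (fun x c => by simp) (fun x c => by simp)]
    refine Finset.sum_congr rfl fun x _ => ?_
    congr 1
    rcases Bool.eq_false_or_eq_true (x i) with hx | hx
    · rw [if_pos hx, ← hx, update_eq_self]
    · rw [if_neg (by simp [hx]), ← hx, update_eq_self]

end Splice

/-! ## §2 Characters under splicing -/

section CharSplice

variable {ι : Type*} [Fintype ι] [DecidableEq ι] {p : ι → ℝ} (h0 : ∀ i, 0 ≤ p i) (h1 : ∀ i, p i ≤ 1) {r : ι → Bool → ℝ}
  (hH1 : ∀ i, p i * r i true + (1 - p i) * r i false = 0)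

include hH1 in
/-- For `|U| = |S|` and `S` disjoint from the queried set `J`: `E_y[χ_U(splice(x,y))·χ_S(y)] = 𝟙[U = S]·E[χ_S²]` — substituting the values
`x_j`, `j ∈ J`, into a level-`k` character produces a multiple of a character of level `≤ k`, of level exactly `k` only if it avoids `J`.
[cite: SchrammSteif2010, §4 proof of Thm 1.8 (ĝ_J(S) = ĝ(S) if S ∩ J = ∅ and 0 otherwise, for |S| = k)] -/
theorem sum_wt_char_splice_mul_char (J U S : Finset ι) (x : ι → Bool) (hSJ : Disjoint S J) (hcard : U.card = S.card) :
    ∑ y : ι → Bool, wt p y * ((∏ i ∈ U, r i (if i ∈ J then x i else y i)) * ∏ i ∈ S, r i (y i))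
      = if U = S then ∑ y : ι → Bool, wt p y * ((∏ i ∈ S, r i (y i)) * ∏ i ∈ S, r i (y i)) else 0 := by
  split_ifs with hUS
  · subst hUS
    refine Finset.sum_congr rfl fun y _ => ?_
    congr 2
    refine Finset.prod_congr rfl fun i hi => ?_
    have : i ∉ J := Finset.disjoint_left.1 hSJ hi
    simp [this]
  · -- a coordinate of `S` outside `U` carries the mean-zero factor `r_i(y_i)`
    obtain ⟨i, hiS, hiU⟩ : ∃ i ∈ S, i ∉ U := by
      by_contra h
      simp only [not_exists, not_and, not_not] at h
      exact hUS (Finset.eq_of_subset_of_card_le (fun i hi => h i hi) hcard.le).symm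
    have hprod : ∀ y : ι → Bool, (∏ i ∈ U, r i (if i ∈ J then x i else y i)) * ∏ i ∈ S, r i (y i)
        = ∏ i, ((if i ∈ U then r i (if i ∈ J then x i else y i) else 1) * (if i ∈ S then r i (y i) else 1)) := by
      intro y
      rw [Finset.prod_mul_distrib, Fintype.prod_ite_mem, Fintype.prod_ite_mem]
    simp_rw [hprod]
    rw [sum_wt_mul_prod p (fun i b => (if i ∈ U then r i (if i ∈ J then x i else b) else 1) * (if i ∈ S then r i b else 1))]
    apply Finset.prod_eq_zero (Finset.mem_univ i)
    simp only [if_neg hiU, if_pos hiS, one_mul]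
    exact hH1 i

end CharSplice

end Summit.CriticalPhenomena.PercolationContinuityZ3.Theorems.Crossing.Spectral

end
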